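import Summits.AtomisticToContinuum.Crystallization.Theorems.ChargedEnergyGapFccScaleNumerics
import HarnessLib

/-!
# Charged energy gap — lens-3 g67, «HcpScaleBox»: the (U-h) BOX certificate of the hcp class REDUCED to four explicit `ℤ³` sums of `(a, h)`

Cell `decomp-a2c`, seat lens-3, generation 67, part P-N⁗·e (APPEND over «FccScaleNumerics» `…Theorems.ChargedEnergyGapFccScaleNumerics`; same namespace,
imports it).  ELEMENTARY·PROVED; complete (no placeholders); standard axioms.

WHAT IT DOES.  The hcp analogue of «FccScaleNumerics».  The hcp stress-free point has NO closed form (floats `(a, h) ≈ (0.9713584, 0.7929975)`,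
`h/a ≈ 0.81638 ≠ √(2/3)`), so (U-h) is a BOX statement: every site-stress-free periodic presentation of an isometric image of an hcp-CLASS Barlow stacking
(Hägg word with alternating letters `s (i+1) = −s i`, window) has `(a, h)` in a small box `[a₁, a₂] × [h₁, h₂]` (on which STAB-h must then hold uniformly —
g68).  Here:
* §N4 `alternatingHagg_succ`, `word_alt_of_succ_eq_neg` / `word_eq_smul_alternating` (an alternating-letter word IS `fun i => s 0 · alternatingHagg i`);
* ★ `Hcp.HcpScaleBox a₁ a₂ h₁ h₂` — TYPED census target: for `ε ∈ {1, −1}` and `(a, h)` in the window, the vanishing of the FOUR explicit sums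
  `Σ'_t virialTermNN a h (ε·alternatingHagg) m 0 0 t`, `Σ'_t virialTerm00 a h (ε·alternatingHagg) m 0 0 t`, `m ∈ {0, 1}` (normal / in-plane site virial at an
  `A`-layer and a `B`-layer base site) puts `(a, h)` in the box (box corners are PARAMETERS — the census chooses them; no decimals in the statement);
* ★★ `Hcp.hcpClass_scale_mem_box : HcpScaleBox a₁ a₂ h₁ h₂ → (every site-stress-free hcp-class presentation has a₁ ≤ a ≤ a₂ ∧ h₁ ≤ h ≤ h₂)` — PROVED
  (rigid-motion presentation, the word is `ε·alternatingHagg`, `IsSiteStressFree.siteVirial_eq_zero` at the two base sites, the four pull-back identities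
  `siteVirial_barlow_eq_tsum` / `siteVirial_barlow00_eq_tsum`);
* `Hcp.hcpStacking_eq_smul_one` (`hcpStacking a h` is the case `ε = 1`).

NOT claimed: `HcpScaleBox` for any box (CERT, census); STAB-h on the box (the hcp block's affine stability, g68); the glide/mirror identities between the four
sums (true, unnecessary for the census).
-/

open scoped Classical
open Literature.MathematicalPhysics.StatisticalMechanics Literature.Geometry.DiscreteGeometry
open Summit.AtomisticToContinuum.Crystallization.Theses.PricedLinkCensus
open Summit.AtomisticToContinuum.Crystallization.Theorems.ChargedEnergyGapNegative

namespace Summit.AtomisticToContinuum.Crystallization.Theorems.ChargedEnergyGapChartDial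

variable {P : PeriodicConfiguration 3}

/-! ## §N4 The hcp class: words with alternating letters are `±alternatingHagg`; the (U-h) BOX certificate in census form -/

section HcpWord

/-- `alternatingHagg (i + 1) = −alternatingHagg i`.
(`private`: file-local twin of the landed `…CLayerWitnessWitness.alternatingHagg_succ` — gate dedup rule; landing lane hand-2 g34.) -/
private theorem alternatingHagg_succ (i : ℤ) : alternatingHagg (i + 1) = -alternatingHagg i := by
  unfold alternatingHagg
  by_cases hi : Even i
  · have : ¬ Even (i + 1) := by simpa [Int.even_add_one] using hi
    simp [hi, this]
  · have : Even (i + 1) := by simpa [Int.even_add_one] using hi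
    simp [hi, this]

/-- A word with alternating letters is `s 0 · alternatingHagg`.
(`private`: file-local twin of the landed `…CLayerWitnessWitness.eq_mul_alternatingHagg` — gate dedup rule; landing lane hand-2 g34.) -/
private theorem word_alt_of_succ_eq_neg {s : ℤ → ℤ} (hs : ∀ i, s (i + 1) = -s i) (i : ℤ) : s i = s 0 * alternatingHagg i := by
  induction i with
  | zero => simp [alternatingHagg]
  | succ n ih => rw [hs, ih, alternatingHagg_succ]; ring
  | pred n ih =>
    have h := hs (-(n : ℤ) - 1)
    rw [sub_add_cancel] at h
    have h2 := alternatingHagg_succ (-(n : ℤ) - 1)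
    rw [sub_add_cancel] at h2
    have h3 : s (-(n : ℤ) - 1) = -s (-(n : ℤ)) := by rw [h]; ring
    rw [h3, ih, h2]; ring

/-- Hence such a word IS `fun i => ε · alternatingHagg i` with `ε = s 0 ∈ {1, −1}` for a Hägg word. -/
theorem word_eq_smul_alternating {s : ℤ → ℤ} (hs : ∀ i, s (i + 1) = -s i) : s = fun i => s 0 * alternatingHagg i :=
  funext (word_alt_of_succ_eq_neg hs)

end HcpWord

namespace Hcp

/-- ★ piece (U-h)-box · UNDECIDED · TRUE-leaning · CERT-able · **THE (U-h) BOX CERTIFICATE IN CENSUS FORM** (parameters: a box `[a₁, a₂] × [h₁, h₂]` to be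
chosen by the census around the float root `(a, h) ≈ (0.9713584, 0.7929975)` of memo g66 §4 / g67 §8): for `ε ∈ {1, −1}` and `(a, h)` in the Barlow window,
if the normal and in-plane site virials of `barlowStacking a h (ε·alternatingHagg)` vanish at the two base sites `barlowPos 0 0 0` (an `A` layer) and
`barlowPos 1 0 0` (a `B` layer) — FOUR explicit `ℤ³` sums of `(a, h)` (`virialTermNN` / `virialTerm00` families) — then `(a, h)` lies in the box.  (The hcp
stress-free point has NO closed form — `h/a ≈ 0.81638 ≠ √(2/3)` — so (U-h) is a box statement, unlike (U-f); by the glide symmetry the site-`1` sums equal the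
site-`0` sums and `ε = −1` is the basal mirror of `ε = 1`, but the census may simply evaluate all of them.)  Why it might fail: only through a second common zero
in the window (none numerically; exterior margin like (U-f)). -/
def HcpScaleBox (a₁ a₂ h₁ h₂ : ℝ) : Prop :=
  ∀ (ε : ℤ) (a h : ℝ), (ε = 1 ∨ ε = -1) → 9 / 10 ≤ a → a ≤ 11 / 10 → 0 < h → 27 / 50 * a ^ 2 ≤ h ^ 2 → h ^ 2 ≤ 121 / 150 * a ^ 2 →
    (∑' t : ℤ × ℤ × ℤ, virialTermNN a h (fun i => ε * alternatingHagg i) 0 0 0 t) = 0 →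
    (∑' t : ℤ × ℤ × ℤ, virialTerm00 a h (fun i => ε * alternatingHagg i) 0 0 0 t) = 0 →
    (∑' t : ℤ × ℤ × ℤ, virialTermNN a h (fun i => ε * alternatingHagg i) 1 0 0 t) = 0 →
    (∑' t : ℤ × ℤ × ℤ, virialTerm00 a h (fun i => ε * alternatingHagg i) 1 0 0 t) = 0 →
    a₁ ≤ a ∧ a ≤ a₂ ∧ h₁ ≤ h ∧ h ≤ h₂

/-- ★★ **(U-h)-box REDUCTION (PROVED)**: given `HcpScaleBox a₁ a₂ h₁ h₂`, EVERY site-stress-free periodic presentation of an isometric image of an hcp-CLASS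
Barlow stacking (Hägg word with alternating letters, window) has its `(a, h)` in the box.  Rigid-motion presentation, the word is `ε·alternatingHagg`
(`word_eq_smul_alternating`), site-stress-freeness at the two base sites, the four pull-back identities. -/
theorem hcpClass_scale_mem_box {a₁ a₂ h₁ h₂ : ℝ} (hN : HcpScaleBox a₁ a₂ h₁ h₂) (P : PeriodicConfiguration 3) {a h : ℝ} {s : ℤ → ℤ} {g : E3 → E3}
    (ha : 9 / 10 ≤ a ∧ a ≤ 11 / 10) (hh : 0 < h ∧ 27 / 50 * a ^ 2 ≤ h ^ 2 ∧ h ^ 2 ≤ 121 / 150 * a ^ 2) (hH : IsHaggSeq s) (hs : ∀ i, s (i + 1) = -s i)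
    (hg : Isometry g) (hP : P.points = g '' barlowStacking a h s) (hS : IsSiteStressFree P) : a₁ ≤ a ∧ a ≤ a₂ ∧ h₁ ≤ h ∧ h ≤ h₂ := by
  obtain ⟨L, c, hLc⟩ := Fcc.exists_linearIsometryEquiv_of_isometry hg
  have ha0 : 0 < a := by linarith [ha.1]
  have hg' : g = fun x => L x + c := funext hLc
  have hw : s = fun i => s 0 * alternatingHagg i := word_eq_smul_alternating hs
  have hP' : P.points = (fun x => L x + c) '' barlowStacking a h (fun i => s 0 * alternatingHagg i) := by rw [hP, hg', ← hw]
  have hy0 : L (barlowPos a h (fun i => s 0 * alternatingHagg i) 0 0 0) + c ∈ P.points := by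
    rw [hP']; exact ⟨_, barlowPos_mem 0 0 0, rfl⟩
  have hy1 : L (barlowPos a h (fun i => s 0 * alternatingHagg i) 1 0 0) + c ∈ P.points := by
    rw [hP']; exact ⟨_, barlowPos_mem 1 0 0, rfl⟩
  have h1 := hS.siteVirial_eq_zero hy0 (L (layerNormal 1)) (L (layerNormal 1))
  rw [siteVirial_barlow_eq_tsum L c ha0 hh.1 hP' 0 0 0] at h1
  have h2 := hS.siteVirial_eq_zero hy0 (L (EuclideanSpace.single (0 : Fin 3) (1 : ℝ))) (L (EuclideanSpace.single (0 : Fin 3) (1 : ℝ)))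
  rw [siteVirial_barlow00_eq_tsum L c ha0 hh.1 hP' 0 0 0] at h2
  have h3 := hS.siteVirial_eq_zero hy1 (L (layerNormal 1)) (L (layerNormal 1))
  rw [siteVirial_barlow_eq_tsum L c ha0 hh.1 hP' 1 0 0] at h3
  have h4 := hS.siteVirial_eq_zero hy1 (L (EuclideanSpace.single (0 : Fin 3) (1 : ℝ))) (L (EuclideanSpace.single (0 : Fin 3) (1 : ℝ)))
  rw [siteVirial_barlow00_eq_tsum L c ha0 hh.1 hP' 1 0 0] at h4
  exact hN (s 0) a h (hH 0) ha.1 ha.2 hh.1 hh.2.1 hh.2.2 h1 h2 h3 h4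

/-- The hcp stacking itself is the case `ε = 1`: `hcpStacking a h = barlowStacking a h (fun i => 1 * alternatingHagg i)`. -/
theorem hcpStacking_eq_smul_one (a h : ℝ) : hcpStacking a h = barlowStacking a h (fun i => 1 * alternatingHagg i) := by
  have : (fun i => 1 * alternatingHagg i) = alternatingHagg := funext fun i => one_mul _
  rw [this]; rfl

end Hcp

end Summit.AtomisticToContinuum.Crystallization.Theorems.ChargedEnergyGapChartDial
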